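import Mathlib
import Summits.Ventures.HodgeRepro.Tier4.Common.LocalUnitary
import Summits.Ventures.HodgeRepro.Tier4.Line4.LocalAssembly

/-!
# Tier4/Line4/LocalBlocks — the local unitary group of a ROW PLANE in `2 × 2` blocks: `U(W)(k_{w₀})` is the group of
block matrices `(x_{IJ} + y_{IJ} ω)` satisfying the scalar unitarity equations

Blind re-derivation cell `pub-hodge-repro`, Tier 4 «prove the step» (README §9–§10), seat t4-L4-p2 (prover, LINE L4,
gen 5; cut C2 of C-COMMON-SL2BALL stage C, statement S15613 (M2), part a: the block algebra over an arbitrary commutative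
ring).  Tree path `lean/Summits/Ventures/HodgeRepro/Tier4/Line4/LocalBlocks.lean`.  Mathlib-level; no literature.
Imports typer-2's `Common/LocalUnitary` (through it `LocalCoordinates`, `RowPlane`, `RowTorus`, `RowWeights`: `re4R`,
`blockDiag4`, `omegaMatR`, `lineGramRowR`, `blockOf`, `blockOf_mul`, `blockOf_mul_lineGramRowR_mul_transpose`,
`block_unitary_scalar`, `commute_omegaMatR_iff`) and this seat's `Line4/LocalAssembly` (`localUnitary`, `omegaAt`,
`gramAt`).

WHAT IS PROVED (over any commutative ring `R`, then at `R = k_{w₀}`).  `blocksOfR M I J` are the four `2 × 2` blocks of a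
`4 × 4` matrix (typer-2's `blocksOf` over `𝔸_k`, now over `R`).  For `Ω = blockDiag (ω, ω)`:
* **`comm_iff_blocks`** — `M Ω = Ω M ↔` every block commutes with `ω` `↔` every block is `x + y ω` with
  `x = M (lineBase I) (lineBase J)`, `y = M (lineOmega I) (lineBase J)` (`blocks_eq_blockOf_of_comm`);
* **`gram_iff_blocks`** — for `B = blockDiag (a G, b G)` (`G = lineGramRowR t n 1`): `M B Mᵀ = B ↔` the four block
  equations `X_{I0} (a G) X_{J0}ᵀ + X_{I1} (b G) X_{J1}ᵀ = δ_{IJ} c_I G`;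
* **`block_eq_iff_scalar`** — for blocks `x + y ω`, each block equation is equivalent to its two SCALAR equations
  `a (z_{I0} z̄_{J0})_p + b (z_{I1} z̄_{J1})_p = δ_{IJ} c_I`, `a (z_{I0} z̄_{J0})_s + b (z_{I1} z̄_{J1})_s = 0`, where
  `z z̄′ = (x x′ + n y y′ + t x y′) + (y x′ − x y′) ω` (typer-2's `block_unitary_scalar` is the forward direction; the
  converse is the trace-form identity read backwards), when `4 n − t²` and `2` are units;
* at `R = k_{w₀}` for the row plane `ofLinesRow q a b ε`: `omegaAt_ofLinesRow`, `gramAt_ofLinesRow` (the rational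
  matrices read in `k_{w₀}` in block form) and **`mem_localUnitary_ofLinesRow_iff`** — `m ∈ U(W)(k_{w₀}) ↔` the blocks of
  `m` are `x_{IJ} + y_{IJ} ω` and the scalar equations hold.

Consumer: `Line4/SliceModel` (the complex reading `x + y ω ↦ Φ x + Φ y · ω_{w₀}` turns the scalar equations into
`m J mᴴ = J`, i.e. `U(W)(k_{w₀}) ≃ₜ* U(J)`).

Nothing here says anything about the status of the Hodge conjecture for CM abelian varieties, which is NOT proved
(HC_CM is NOT proved by anyone in this repository).
-/

set_option autoImplicit false

noncomputable section

namespace Summit.Ventures.HodgeRepro.Tier4.Line4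

open Summit.Ventures.HodgeRepro.Tier4.Common NumberField Matrix

/-! ## 1. Blocks of a `4 × 4` matrix over a commutative ring -/

section Blocks

variable {R : Type} [CommRing R]

/-- The four `2 × 2` blocks of a `4 × 4` matrix (`I J : Fin 2`), through `re4R`. -/
def blocksOfR (M : Matrix (Fin 4) (Fin 4) R) (I J : Fin 2) : Matrix (Fin 2) (Fin 2) R :=
  fun i j => ((re4R (R := R)).symm M) (if I = 0 then Sum.inl i else Sum.inr i) (if J = 0 then Sum.inl j else Sum.inr j)

/-- A matrix is `re4R` of the block matrix of its blocks. -/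
theorem eq_re4R_fromBlocks_blocksOfR (M : Matrix (Fin 4) (Fin 4) R) :
    M = re4R (fromBlocks (blocksOfR M 0 0) (blocksOfR M 0 1) (blocksOfR M 1 0) (blocksOfR M 1 1)) := by
  have h : fromBlocks (blocksOfR M 0 0) (blocksOfR M 0 1) (blocksOfR M 1 0) (blocksOfR M 1 1) =
      (re4R (R := R)).symm M := by
    rw [← fromBlocks_toBlocks ((re4R (R := R)).symm M)]
    rfl
  rw [h, AlgEquiv.apply_symm_apply]

/-- The `(0, 0)` entry of a block. -/
theorem blocksOfR_apply_zero_zero (M : Matrix (Fin 4) (Fin 4) R) (I J : Fin 2) :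
    blocksOfR M I J 0 0 = M (lineBase I) (lineBase J) := by
  conv_rhs => rw [eq_re4R_fromBlocks_blocksOfR M]
  fin_cases I <;> fin_cases J <;> rfl

/-- The `(1, 0)` entry of a block. -/
theorem blocksOfR_apply_one_zero (M : Matrix (Fin 4) (Fin 4) R) (I J : Fin 2) :
    blocksOfR M I J 1 0 = M (lineOmega I) (lineBase J) := by
  conv_rhs => rw [eq_re4R_fromBlocks_blocksOfR M]
  fin_cases I <;> fin_cases J <;> rfl

/-- The blocks of `re4R N` are the entries of `N` on the summands. -/
theorem blocksOfR_re4R (N : Matrix (Fin 2 ⊕ Fin 2) (Fin 2 ⊕ Fin 2) R) (I J : Fin 2) :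
    blocksOfR (re4R N) I J =
      fun i j => N (if I = 0 then Sum.inl i else Sum.inr i) (if J = 0 then Sum.inl j else Sum.inr j) := by
  funext i j
  simp only [blocksOfR, AlgEquiv.symm_apply_apply]

/-- The four blocks of `re4R (fromBlocks A B C D)`. -/
theorem blocksOfR_re4R_fromBlocks (A B C D : Matrix (Fin 2) (Fin 2) R) :
    blocksOfR (re4R (fromBlocks A B C D)) 0 0 = A ∧ blocksOfR (re4R (fromBlocks A B C D)) 0 1 = B ∧
      blocksOfR (re4R (fromBlocks A B C D)) 1 0 = C ∧ blocksOfR (re4R (fromBlocks A B C D)) 1 1 = D := by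
  refine ⟨?_, ?_, ?_, ?_⟩ <;> rw [blocksOfR_re4R] <;> funext i j <;> simp [fromBlocks]

/-- The blocks of a product are the block products. -/
theorem blocksOfR_mul (M N : Matrix (Fin 4) (Fin 4) R) (I J : Fin 2) :
    blocksOfR (M * N) I J = blocksOfR M I 0 * blocksOfR N 0 J + blocksOfR M I 1 * blocksOfR N 1 J := by
  have h : M * N = re4R (fromBlocks (blocksOfR M 0 0 * blocksOfR N 0 0 + blocksOfR M 0 1 * blocksOfR N 1 0)
      (blocksOfR M 0 0 * blocksOfR N 0 1 + blocksOfR M 0 1 * blocksOfR N 1 1)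
      (blocksOfR M 1 0 * blocksOfR N 0 0 + blocksOfR M 1 1 * blocksOfR N 1 0)
      (blocksOfR M 1 0 * blocksOfR N 0 1 + blocksOfR M 1 1 * blocksOfR N 1 1)) := by
    conv_lhs => rw [eq_re4R_fromBlocks_blocksOfR M, eq_re4R_fromBlocks_blocksOfR N]
    rw [← map_mul, fromBlocks_multiply]
  rw [h]
  obtain ⟨h00, h01, h10, h11⟩ := blocksOfR_re4R_fromBlocks
    (blocksOfR M 0 0 * blocksOfR N 0 0 + blocksOfR M 0 1 * blocksOfR N 1 0)
    (blocksOfR M 0 0 * blocksOfR N 0 1 + blocksOfR M 0 1 * blocksOfR N 1 1)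
    (blocksOfR M 1 0 * blocksOfR N 0 0 + blocksOfR M 1 1 * blocksOfR N 1 0)
    (blocksOfR M 1 0 * blocksOfR N 0 1 + blocksOfR M 1 1 * blocksOfR N 1 1)
  fin_cases I <;> fin_cases J
  · exact h00
  · exact h01
  · exact h10
  · exact h11

/-- The blocks of the identity. -/
theorem blocksOfR_one (I J : Fin 2) :
    blocksOfR (1 : Matrix (Fin 4) (Fin 4) R) I J = if I = J then 1 else 0 := by
  have h : (1 : Matrix (Fin 4) (Fin 4) R) = re4R (fromBlocks 1 0 0 1) := by
    rw [fromBlocks_one, map_one]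
  rw [h]
  obtain ⟨h00, h01, h10, h11⟩ := blocksOfR_re4R_fromBlocks (1 : Matrix (Fin 2) (Fin 2) R) 0 0 1
  fin_cases I <;> fin_cases J
  · simpa using h00
  · simpa using h01
  · simpa using h10
  · simpa using h11

/-- `re4R` commutes with transposition. -/
theorem re4R_transpose' (N : Matrix (Fin 2 ⊕ Fin 2) (Fin 2 ⊕ Fin 2) R) : (re4R N)ᵀ = re4R Nᵀ := by
  simp only [re4R, coe_reindexAlgEquiv, transpose_reindex]

/-- **Commuting with `blockDiag (ω, ω)` is commuting block by block.** -/
theorem comm_iff_blocks (ω : Matrix (Fin 2) (Fin 2) R) (M : Matrix (Fin 4) (Fin 4) R) :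
    M * re4R (fromBlocks ω 0 0 ω) = re4R (fromBlocks ω 0 0 ω) * M ↔
      ∀ I J : Fin 2, blocksOfR M I J * ω = ω * blocksOfR M I J := by
  constructor
  · intro h I J
    conv_lhs at h => rw [eq_re4R_fromBlocks_blocksOfR M]
    conv_rhs at h => rw [eq_re4R_fromBlocks_blocksOfR M]
    rw [← map_mul, ← map_mul, fromBlocks_multiply, fromBlocks_multiply] at h
    have h' := (re4R (R := R)).injective h
    simp only [Matrix.mul_zero, Matrix.zero_mul, add_zero, zero_add] at h'
    obtain ⟨h00, h01, h10, h11⟩ := fromBlocks_inj.1 h'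
    fin_cases I <;> fin_cases J
    · exact h00
    · exact h01
    · exact h10
    · exact h11
  · intro h
    conv_lhs => rw [eq_re4R_fromBlocks_blocksOfR M]
    conv_rhs => rw [eq_re4R_fromBlocks_blocksOfR M]
    rw [← map_mul, ← map_mul, fromBlocks_multiply, fromBlocks_multiply]
    simp only [Matrix.mul_zero, Matrix.zero_mul, add_zero, zero_add, h 0 0, h 0 1, h 1 0, h 1 1]

/-- **A matrix commuting with `blockDiag (ω, ω)` has blocks `x + y ω`** (`x`, `y` the two entries of the block). -/
theorem blocks_eq_blockOf_of_comm (t n : R) {M : Matrix (Fin 4) (Fin 4) R}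
    (h : M * re4R (fromBlocks (omegaMatR t n) 0 0 (omegaMatR t n)) =
      re4R (fromBlocks (omegaMatR t n) 0 0 (omegaMatR t n)) * M) (I J : Fin 2) :
    blocksOfR M I J = blockOf t n (M (lineBase I) (lineBase J)) (M (lineOmega I) (lineBase J)) := by
  have h' := (commute_omegaMatR_iff _ _ _).1 ((comm_iff_blocks _ M).1 h I J)
  rw [blocksOfR_apply_zero_zero, blocksOfR_apply_one_zero] at h'
  exact h'

/-- Conversely, a matrix whose blocks are of the form `x + y ω` commutes with `blockDiag (ω, ω)`. -/
theorem comm_of_blocks_eq_blockOf (t n : R) {M : Matrix (Fin 4) (Fin 4) R} (x y : Fin 2 → Fin 2 → R)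
    (h : ∀ I J, blocksOfR M I J = blockOf t n (x I J) (y I J)) :
    M * re4R (fromBlocks (omegaMatR t n) 0 0 (omegaMatR t n)) =
      re4R (fromBlocks (omegaMatR t n) 0 0 (omegaMatR t n)) * M := by
  rw [comm_iff_blocks]
  intro I J
  rw [h I J]
  exact blockOf_mul_omegaMatR t n _ _

/-- **The isometry relation for `blockDiag (a G, b G)` is four block equations.** -/
theorem gram_iff_blocks (G : Matrix (Fin 2) (Fin 2) R) (a b : R) (M : Matrix (Fin 4) (Fin 4) R) :
    M * re4R (fromBlocks (a • G) 0 0 (b • G)) * Mᵀ = re4R (fromBlocks (a • G) 0 0 (b • G)) ↔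
      (blocksOfR M 0 0 * (a • G) * (blocksOfR M 0 0)ᵀ + blocksOfR M 0 1 * (b • G) * (blocksOfR M 0 1)ᵀ = a • G ∧
        blocksOfR M 0 0 * (a • G) * (blocksOfR M 1 0)ᵀ + blocksOfR M 0 1 * (b • G) * (blocksOfR M 1 1)ᵀ = 0) ∧
      (blocksOfR M 1 0 * (a • G) * (blocksOfR M 0 0)ᵀ + blocksOfR M 1 1 * (b • G) * (blocksOfR M 0 1)ᵀ = 0 ∧
        blocksOfR M 1 0 * (a • G) * (blocksOfR M 1 0)ᵀ + blocksOfR M 1 1 * (b • G) * (blocksOfR M 1 1)ᵀ = b • G) := by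
  have key : M * re4R (fromBlocks (a • G) 0 0 (b • G)) * Mᵀ =
      re4R (fromBlocks
        (blocksOfR M 0 0 * (a • G) * (blocksOfR M 0 0)ᵀ + blocksOfR M 0 1 * (b • G) * (blocksOfR M 0 1)ᵀ)
        (blocksOfR M 0 0 * (a • G) * (blocksOfR M 1 0)ᵀ + blocksOfR M 0 1 * (b • G) * (blocksOfR M 1 1)ᵀ)
        (blocksOfR M 1 0 * (a • G) * (blocksOfR M 0 0)ᵀ + blocksOfR M 1 1 * (b • G) * (blocksOfR M 0 1)ᵀ)
        (blocksOfR M 1 0 * (a • G) * (blocksOfR M 1 0)ᵀ + blocksOfR M 1 1 * (b • G) * (blocksOfR M 1 1)ᵀ)) := by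
    conv_lhs => rw [eq_re4R_fromBlocks_blocksOfR M]
    rw [re4R_transpose', fromBlocks_transpose, ← map_mul, ← map_mul, fromBlocks_multiply, fromBlocks_multiply]
    simp only [Matrix.mul_zero, add_zero, zero_add]
  rw [key]
  constructor
  · intro h
    have h' := (re4R (R := R)).injective h
    obtain ⟨h00, h01, h10, h11⟩ := fromBlocks_inj.1 h'
    exact ⟨⟨h00, h01⟩, ⟨h10, h11⟩⟩
  · rintro ⟨⟨h00, h01⟩, ⟨h10, h11⟩⟩
    rw [h00, h01, h10, h11]

/-- **A block equation in scalar form** (`4 n − t²` and `2` units): for blocks `x + y ω`,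
`X₀ (a G) X₀′ᵀ + X₁ (b G) X₁′ᵀ = d G ↔ a (z₀ z̄₀′)_p + b (z₁ z̄₁′)_p = d ∧ a (z₀ z̄₀′)_s + b (z₁ z̄₁′)_s = 0`. -/
theorem block_eq_iff_scalar (t n : R) (hu : IsUnit (4 * n - t ^ 2)) (h2 : IsUnit (2 : R))
    (a b x₀ y₀ x₀' y₀' x₁ y₁ x₁' y₁' d : R) :
    blockOf t n x₀ y₀ * (a • lineGramRowR t n 1) * (blockOf t n x₀' y₀')ᵀ +
        blockOf t n x₁ y₁ * (b • lineGramRowR t n 1) * (blockOf t n x₁' y₁')ᵀ = d • lineGramRowR t n 1 ↔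
      a * (x₀ * x₀' + n * y₀ * y₀' + t * x₀ * y₀') + b * (x₁ * x₁' + n * y₁ * y₁' + t * x₁ * y₁') = d ∧
        a * (y₀ * x₀' - x₀ * y₀') + b * (y₁ * x₁' - x₁ * y₁') = 0 := by
  rw [Matrix.mul_smul, Matrix.smul_mul, Matrix.mul_smul, Matrix.smul_mul]
  constructor
  · exact fun h => block_unitary_scalar hu h2 h
  · rintro ⟨hp, hs⟩
    rw [blockOf_mul_lineGramRowR_mul_transpose, blockOf_mul_lineGramRowR_mul_transpose, one_smul, one_smul,
      ← Matrix.smul_mul, ← Matrix.smul_mul, smul_blockOf, smul_blockOf, ← Matrix.add_mul, blockOf_add]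
    have hd : d • lineGramRowR t n 1 = blockOf t n d 0 * lineGramRowR t n 1 := by
      calc d • lineGramRowR t n 1 = (d • (1 : Matrix (Fin 2) (Fin 2) R)) * lineGramRowR t n 1 := by
            rw [Matrix.smul_mul, Matrix.one_mul]
        _ = blockOf t n d 0 * lineGramRowR t n 1 := by
            rw [← blockOf_one_zero t n, smul_blockOf, mul_one, mul_zero]
    rw [hd]
    congr 2

end Blocks

/-! ## 2. The row plane at an infinite place: `Ω_{w₀}`, `B_{w₀}` in block form; membership in `U(W)(k_{w₀})` -/

section RowPlane

variable {k : Type} [Field k] [NumberField k] (q : QuadData k) (a b ε : k) (w₀ : InfinitePlace k)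

omit [NumberField k] in
/-- `blockDiag4` transports along a ring homomorphism. -/
theorem blockDiag4_map (f : k →+* w₀.Completion) (A D : Matrix (Fin 2) (Fin 2) k) :
    (blockDiag4 A D).map f = re4R (fromBlocks (A.map f) 0 0 (D.map f)) := by
  simp only [blockDiag4, re4, re4R, coe_reindexAlgEquiv, Matrix.reindex_apply]
  rw [← Matrix.submatrix_map, fromBlocks_map, Matrix.map_zero _ (map_zero _)]

omit [NumberField k] in
/-- `Ω_{w₀}` of the row plane is `blockDiag (ω, ω)` over `k_{w₀}`. -/
theorem omegaAt_ofLinesRow :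
    omegaAt (PlaneData.ofLinesRow q a b ε) w₀ =
      re4R (fromBlocks (omegaMatR (algebraMap k w₀.Completion q.t) (algebraMap k w₀.Completion q.n)) 0 0
        (omegaMatR (algebraMap k w₀.Completion q.t) (algebraMap k w₀.Completion q.n))) := by
  have h : (PlaneData.ofLinesRow q a b ε).Ω = blockDiag4 (omegaMat q) (omegaMat q) := rfl
  show (PlaneData.ofLinesRow q a b ε).Ω.map (algebraMap k w₀.Completion) = _
  rw [h, blockDiag4_map, omegaMat_map]

/-- `lineGramRowR t n c = c • lineGramRowR t n 1`. -/
theorem lineGramRowR_eq_smul {R : Type} [CommRing R] (t n c : R) :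
    lineGramRowR t n c = c • lineGramRowR t n 1 := by
  ext i j
  fin_cases i <;> fin_cases j <;> simp [lineGramRowR]

omit [NumberField k] in
/-- `B_{w₀}` of the row plane is `blockDiag (a G, ε b G)` over `k_{w₀}`, `G = lineGramRowR t n 1`. -/
theorem gramAt_ofLinesRow :
    gramAt (PlaneData.ofLinesRow q a b ε) w₀ =
      re4R (fromBlocks
        (algebraMap k w₀.Completion a •
          lineGramRowR (algebraMap k w₀.Completion q.t) (algebraMap k w₀.Completion q.n) 1) 0 0
        (algebraMap k w₀.Completion (ε * b) •
          lineGramRowR (algebraMap k w₀.Completion q.t) (algebraMap k w₀.Completion q.n) 1)) := by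
  have h : (PlaneData.ofLinesRow q a b ε).B = blockDiag4 (lineGramRow q a) (lineGramRow q (ε * b)) := by
    show blockDiag4 (lineGramRow q a) (ε • lineGramRow q b) = _
    rw [smul_lineGramRow]
  show (PlaneData.ofLinesRow q a b ε).B.map (algebraMap k w₀.Completion) = _
  rw [h, blockDiag4_map, lineGramRow_map, lineGramRow_map, lineGramRowR_eq_smul _ _ (algebraMap k w₀.Completion a),
    lineGramRowR_eq_smul _ _ (algebraMap k w₀.Completion (ε * b))]

/-- The local quadratic data: `t`, `n` read in `k_{w₀}`. -/
abbrev tLoc : w₀.Completion := algebraMap k w₀.Completion q.t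

/-- `n` read in `k_{w₀}`. -/
abbrev nLoc : w₀.Completion := algebraMap k w₀.Completion q.n

/-- **The scalar unitarity equations of a block matrix `(x_{IJ} + y_{IJ} ω)`** over `k_{w₀}` for the row plane:
`a (z_{I0} z̄_{J0})_p + ε b (z_{I1} z̄_{J1})_p = δ_{IJ} c_I` and `a (z_{I0} z̄_{J0})_s + ε b (z_{I1} z̄_{J1})_s = 0`. -/
def ScalarUnitary (x y : Fin 2 → Fin 2 → w₀.Completion) : Prop :=
  ∀ I J : Fin 2,
    algebraMap k w₀.Completion a *
        (x I 0 * x J 0 + nLoc q w₀ * y I 0 * y J 0 + tLoc q w₀ * x I 0 * y J 0) +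
      algebraMap k w₀.Completion (ε * b) *
        (x I 1 * x J 1 + nLoc q w₀ * y I 1 * y J 1 + tLoc q w₀ * x I 1 * y J 1) =
      (if I = J then (if I = 0 then algebraMap k w₀.Completion a else algebraMap k w₀.Completion (ε * b)) else 0) ∧
    algebraMap k w₀.Completion a * (y I 0 * x J 0 - x I 0 * y J 0) +
      algebraMap k w₀.Completion (ε * b) * (y I 1 * x J 1 - x I 1 * y J 1) = 0

omit [NumberField k] in
/-- `4 n − t²` is a unit of `k_{w₀}` when it is non-zero in `k`. -/
theorem isUnit_disc_loc (hq : 4 * q.n - q.t ^ 2 ≠ 0) : IsUnit (4 * nLoc q w₀ - tLoc q w₀ ^ 2) := by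
  have h : 4 * nLoc q w₀ - tLoc q w₀ ^ 2 = algebraMap k w₀.Completion (4 * q.n - q.t ^ 2) := by
    simp only [nLoc, tLoc, map_sub, map_mul, map_pow, map_ofNat]
  rw [h]
  exact (isUnit_iff_ne_zero.2 hq).map (algebraMap k w₀.Completion)

/-- `2` is a unit of `k_{w₀}`. -/
theorem isUnit_two_loc : IsUnit (2 : w₀.Completion) := by
  have h : (2 : w₀.Completion) = algebraMap k w₀.Completion 2 := (map_ofNat (algebraMap k w₀.Completion) 2).symm
  rw [h]
  exact (isUnit_iff_ne_zero.2 two_ne_zero).map (algebraMap k w₀.Completion)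

/-- The `(I, J)` block equation of the row-plane isometry relation, in the raw block form of `gram_iff_blocks`. -/
theorem blockEq_iff_scalar_ofLinesRow (hq : 4 * q.n - q.t ^ 2 ≠ 0) (x y : Fin 2 → Fin 2 → w₀.Completion)
    (I J : Fin 2) :
    blockOf (tLoc q w₀) (nLoc q w₀) (x I 0) (y I 0) *
          (algebraMap k w₀.Completion a • lineGramRowR (tLoc q w₀) (nLoc q w₀) 1) *
          (blockOf (tLoc q w₀) (nLoc q w₀) (x J 0) (y J 0))ᵀ +
        blockOf (tLoc q w₀) (nLoc q w₀) (x I 1) (y I 1) *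
          (algebraMap k w₀.Completion (ε * b) • lineGramRowR (tLoc q w₀) (nLoc q w₀) 1) *
          (blockOf (tLoc q w₀) (nLoc q w₀) (x J 1) (y J 1))ᵀ =
        (if I = J then (if I = 0 then algebraMap k w₀.Completion a else algebraMap k w₀.Completion (ε * b)) else 0) •
          lineGramRowR (tLoc q w₀) (nLoc q w₀) 1 ↔
      (algebraMap k w₀.Completion a *
          (x I 0 * x J 0 + nLoc q w₀ * y I 0 * y J 0 + tLoc q w₀ * x I 0 * y J 0) +
        algebraMap k w₀.Completion (ε * b) *
          (x I 1 * x J 1 + nLoc q w₀ * y I 1 * y J 1 + tLoc q w₀ * x I 1 * y J 1) =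
        (if I = J then (if I = 0 then algebraMap k w₀.Completion a else algebraMap k w₀.Completion (ε * b)) else 0) ∧
      algebraMap k w₀.Completion a * (y I 0 * x J 0 - x I 0 * y J 0) +
        algebraMap k w₀.Completion (ε * b) * (y I 1 * x J 1 - x I 1 * y J 1) = 0) :=
  block_eq_iff_scalar (tLoc q w₀) (nLoc q w₀) (isUnit_disc_loc q w₀ hq) (isUnit_two_loc w₀) _ _ _ _ _ _ _ _ _ _ _

/-- **Membership in `U(W)(k_{w₀})` for the row plane, in coordinates**: `m ∈ localUnitary ↔` its blocks are
`x_{IJ} + y_{IJ} ω` (`x_{IJ} = m (lineBase I) (lineBase J)`, `y_{IJ} = m (lineOmega I) (lineBase J)`) and the scalar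
unitarity equations `ScalarUnitary` hold. -/
theorem mem_localUnitary_ofLinesRow_iff (hq : 4 * q.n - q.t ^ 2 ≠ 0) (m : GL (Fin 4) w₀.Completion) :
    m ∈ localUnitary (PlaneData.ofLinesRow q a b ε) w₀ ↔
      (∀ I J : Fin 2, blocksOfR (m : Matrix (Fin 4) (Fin 4) w₀.Completion) I J =
          blockOf (tLoc q w₀) (nLoc q w₀) ((m : Matrix (Fin 4) (Fin 4) w₀.Completion) (lineBase I) (lineBase J))
            ((m : Matrix (Fin 4) (Fin 4) w₀.Completion) (lineOmega I) (lineBase J))) ∧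
        ScalarUnitary q a b ε w₀ (fun I J => (m : Matrix (Fin 4) (Fin 4) w₀.Completion) (lineBase I) (lineBase J))
          (fun I J => (m : Matrix (Fin 4) (Fin 4) w₀.Completion) (lineOmega I) (lineBase J)) := by
  rw [mem_localUnitary, omegaAt_ofLinesRow, gramAt_ofLinesRow, gram_iff_blocks]
  set M : Matrix (Fin 4) (Fin 4) w₀.Completion := (m : Matrix (Fin 4) (Fin 4) w₀.Completion) with hM
  set x : Fin 2 → Fin 2 → w₀.Completion := fun I J => M (lineBase I) (lineBase J) with hx
  set y : Fin 2 → Fin 2 → w₀.Completion := fun I J => M (lineOmega I) (lineBase J) with hy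
  have hsc := fun I J => blockEq_iff_scalar_ofLinesRow q a b ε w₀ hq x y I J
  constructor
  · rintro ⟨hΩ, hB⟩
    have hbl : ∀ I J, blocksOfR M I J = blockOf (tLoc q w₀) (nLoc q w₀) (x I J) (y I J) :=
      fun I J => blocks_eq_blockOf_of_comm _ _ hΩ I J
    refine ⟨hbl, fun I J => ?_⟩
    obtain ⟨⟨h00, h01⟩, ⟨h10, h11⟩⟩ := hB
    simp only [hbl] at h00 h01 h10 h11
    fin_cases I <;> fin_cases J
    · exact (hsc 0 0).1 (by simpa using h00)
    · exact (hsc 0 1).1 (by simpa using h01)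
    · exact (hsc 1 0).1 (by simpa using h10)
    · exact (hsc 1 1).1 (by simpa using h11)
  · rintro ⟨hbl, hS⟩
    refine ⟨comm_of_blocks_eq_blockOf _ _ x y hbl, ?_⟩
    simp only [hbl]
    refine ⟨⟨?_, ?_⟩, ⟨?_, ?_⟩⟩
    · simpa using (hsc 0 0).2 (hS 0 0)
    · simpa using (hsc 0 1).2 (hS 0 1)
    · simpa using (hsc 1 0).2 (hS 1 0)
    · simpa using (hsc 1 1).2 (hS 1 1)

end RowPlane

end Summit.Ventures.HodgeRepro.Tier4.Line4

end
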